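import Summits.RiemannHypothesis.RiemannHypothesis.Theorems.WeilFormatCCinfHankelRange
import Summits.RiemannHypothesis.RiemannHypothesis.Theorems.WeilFormatCCinfLogTails
import Summits.RiemannHypothesis.RiemannHypothesis.Theorems.WeilFormatCCinfTrigTails
import Summits.RiemannHypothesis.RiemannHypothesis.Theorems.WeilFormatCCinfLogTrigTails
import Summits.RiemannHypothesis.RiemannHypothesis.Theorems.WeilFormatCOscTailProducts
import Summits.RiemannHypothesis.RiemannHypothesis.Theorems.WeilFormatCCinfGramHankel
import HarnessLib

/-!
# Format C, design C∞ (E2c, data side): FAR TAILS of the Hankel entries, part 1 — smooth pairs and single-frequency trig pairs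

Route context: Fourier–Galerkin / Schur-complement certificates of Weil positivity on a window ("format C", C∞ door
`weilPositivityOn_of_cinf_pipeline`; supporting stmt-RiemannHypothesis-0098; seat rh-explicit-weil-2; companion of
`WeilFormatCCinfHankelRange` (`CinfHankelR.mem_entry` wants a box of the far tail `Σ'_k T_t(B₄+k) T_t'(B₄+k) (m₀/(B₄+k))^s`)).

Measured need (gen18 kit sweeps j239104/j239112/j239135, a = 1, range L = 512): smooth tails must be tight (they are: Hurwitz E–M /
F–G brackets), the trig-involving tails only need an OSCILLATORY (Abel-type) bound of quality O(1) at small `s` and tolerate the crude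
absolute majorant at large `s`.  This file turns the landed evaluators into boxes of the far tails IN THE DOOR'S TAG SPELLING
(`CinfHankelR.tagT`):

* `far00/far01/far11` (+ `mem_…`) — `pureFarScaledBox`, `logFarScaledBox`, `logSqFarScaledBox` (`WeilFormatCCinfLogTails`);
* `phaseBox`/`mem_phaseBox` — `φ_q = π ℓ_q / a` from the constants record; `far02/far03` (+ `mem_…`) — the single-frequency trig tails
  `∓Σ_q w_q Σ'_k cos/sin((B₄+k)φ_q)(m₀/(B₄+k))^s` by `trigFarScaledBox` (K-fold Abel, `WeilFormatCCinfTrigTails`), summed over the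
  prime list with the weights of the record (`Encl.sum_weilPrimeIndex_eq_listSum`);
* `crudeFar`/`mem_crudeFar` — for ANY pair: `|far| ≤ c_t c_t' · Σ'_k w(B₄+k)(m₀/(B₄+k))^s` with `c = (1, 1, Λ, Λ)` and the weight
  `w ∈ {1, log, log²}` counting the `log` tags (`|C_m|, |S_m| ≤ Λ := Σ_q w_q`), as a symmetric box (`CinfHankelR.mem_symBox_of_abs_le`).

Interval bookkeeping over landed evaluators; standard axioms; no RH claim.
-/

set_option autoImplicit false
-- `Summit.RiemannHypothesis.RiemannHypothesis.…` is the layout-mandated namespace (summit = problem name).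
set_option linter.dupNamespace false

open Finset
open scoped Real ArithmeticFunction.vonMangoldt

namespace Summit.RiemannHypothesis.RiemannHypothesis.Theorems.WeilFormatC

namespace CinfHankelR

open Literature.NumberTheory.LFunctions Literature.NumberTheory.LFunctions.Yoshida1992 Literature.Analysis.SpecialFunctions
open Literature.Analysis.ValidatedNumerics Literature.Analysis.ValidatedNumerics.NumericsMP
open Encl (Consts ConstsValid)
open WinEntry (sumBox mem_sumBox)
open CinfCoeff (pureFarScaledBox mem_pureFarScaledBox logFarScaledBox mem_logFarScaledBox logSqFarScaledBox mem_logSqFarScaledBox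
  trigFarScaledBox mem_trigFarScaledBox)

variable {S : ℕ} {a : ℝ} {ks : List PrimeLen} {C : Consts}

/-! ## The tags, componentwise -/

/-- tag `0` is the constant `1`. -/
theorem tagT_zero (a : ℝ) (m : ℕ) : tagT a 0 m = 1 := rfl
/-- tag `1` is `log m`. -/
theorem tagT_one (a : ℝ) (m : ℕ) : tagT a 1 m = Real.log m := rfl
/-- tag `2` is `−C_m` (prime cosine sum). -/
theorem tagT_two (a : ℝ) (m : ℕ) :
    tagT a 2 m = -(∑ n ∈ weilPrimeIndex a, (Λ n : ℝ) / Real.sqrt n * Real.cos (π * m / a * Real.log n)) := rfl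
/-- tag `3` is `S_m` (prime sine sum). -/
theorem tagT_three (a : ℝ) (m : ℕ) :
    tagT a 3 m = ∑ n ∈ weilPrimeIndex a, (Λ n : ℝ) / Real.sqrt n * Real.sin (π * m / a * Real.log n) := rfl

/-- The far tail of the pair `(t, t')` from `B₄`, rescaled by `m₀`. -/
noncomputable def farSum (a : ℝ) (m₀ B₄ : ℕ) (t t' : Fin 4) (s : ℕ) : ℝ :=
  ∑' k : ℕ, tagT a t (B₄ + k) * tagT a t' (B₄ + k) * ((m₀ : ℝ) / ((B₄ + k : ℕ) : ℝ)) ^ s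

/-- `farSum` is symmetric in the tags. -/
theorem farSum_symm (a : ℝ) (m₀ B₄ : ℕ) (t t' : Fin 4) (s : ℕ) : farSum a m₀ B₄ t t' s = farSum a m₀ B₄ t' t s := by
  unfold farSum; congr 1; funext k; ring

/-! ## Smooth pairs -/

/-- `far00 ∋ farSum (0,0)`: Hurwitz Euler–Maclaurin (`J` terms, `ν` Bernoulli corrections). -/
theorem mem_far00 {m₀ B₄ s : ℕ} (hB₄ : 0 < B₄) (hs : 2 ≤ s) (J : ℕ) {ν : ℕ} (hν : ν ≠ 0) :
    MI.mem S (farSum a m₀ B₄ 0 0 s) (pureFarScaledBox S m₀ B₄ s J ν) := by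
  have h := mem_pureFarScaledBox (S := S) (m₀ := m₀) hB₄ hs J hν
  unfold farSum
  simpa [tagT_zero] using h

/-- `far01 ∋ farSum (0,1)`: the F–G log bracket (`K` log-series terms). -/
theorem mem_far01 (hS : 0 < S) {K m₀ B₄ s : ℕ} (hB₄ : 3 ≤ B₄) (hs : 2 ≤ s) {B : MI}
    (h : logFarScaledBox S K m₀ B₄ s = some B) : MI.mem S (farSum a m₀ B₄ 0 1 s) B := by
  have hm := mem_logFarScaledBox hS hB₄ hs h
  unfold farSum
  simpa [tagT_zero, tagT_one] using hm

/-- `far11 ∋ farSum (1,1)`: the log² bracket. -/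
theorem mem_far11 (hS : 0 < S) {K m₀ B₄ s : ℕ} (hB₄ : 4 ≤ B₄) (hs : 2 ≤ s) {B : MI}
    (h : logSqFarScaledBox S K m₀ B₄ s = some B) : MI.mem S (farSum a m₀ B₄ 1 1 s) B := by
  have hm := mem_logSqFarScaledBox hS hB₄ hs h
  unfold farSum
  simp only [tagT_one]
  convert hm using 2
  funext k
  ring

/-! ## Phases and the single-frequency trig pairs -/

/-- Box of the frequency `φ_i = π ℓ_i / a` of the `i`-th prime power. -/
def phaseBox (S : ℕ) (C : Consts) (i : ℕ) : MI := (C.P.mul S (C.lens.getD i default)).mul S C.invA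

/-- `phaseBox ∋ π ℓ_i / a`. -/
theorem mem_phaseBox (hS : 0 < S) (hC : ConstsValid S a ks C) {i : ℕ} (hi : i < ks.length) :
    MI.mem S (π * (ks.getD i default).len / a) (phaseBox S C i) := by
  have h := MI.mem_mul hS (MI.mem_mul hS hC.pi (hC.lens i hi)) hC.invA
  exact Encl.mem_of_eq h (by ring)

/-- The list of per-frequency trig far boxes `(cos, sin)` (`none` if one fails). -/
def trigFarList (S Ke ke : ℕ) (C : Consts) (nks m₀ B₄ s K : ℕ) : Option (List (MI × MI)) :=
  Encl.omap (fun i ↦ trigFarScaledBox S Ke ke C.P (phaseBox S C i) m₀ B₄ s K) (List.range nks)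

/-- Weighted sum of the cosine far boxes: `Σ_{i<n} W_i · L_i.1`. -/
def wsumCos (S : ℕ) (W : List MI) (L : List (MI × MI)) (n : ℕ) : MI :=
  sumBox S (fun i ↦ (W.getD i default).mul S (L.getD i default).1) n

/-- Weighted sum of the sine far boxes: `Σ_{i<n} W_i · L_i.2`. -/
def wsumSin (S : ℕ) (W : List MI) (L : List (MI × MI)) (n : ℕ) : MI :=
  sumBox S (fun i ↦ (W.getD i default).mul S (L.getD i default).2) n

/-- What the `i`-th entry of `trigFarList` encloses. -/
theorem mem_trigFarList (hS : 0 < S) (hC : ConstsValid S a ks C) {Ke ke m₀ B₄ s K : ℕ} (hB₄ : 1 ≤ B₄) (hs : 2 ≤ s)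
    (hK : 1 ≤ K) (hKe : Even K) {L : List (MI × MI)} (hL : trigFarList S Ke ke C ks.length m₀ B₄ s K = some L)
    {i : ℕ} (hi : i < ks.length) :
    MI.mem S (∑' k : ℕ, Real.cos ((B₄ + k : ℕ) * (π * (ks.getD i default).len / a)) * ((m₀ : ℝ) / ((B₄ + k : ℕ) : ℝ)) ^ s)
        (L.getD i default).1 ∧
      MI.mem S (∑' k : ℕ, Real.sin ((B₄ + k : ℕ) * (π * (ks.getD i default).len / a)) * ((m₀ : ℝ) / ((B₄ + k : ℕ) : ℝ)) ^ s)
        (L.getD i default).2 := by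
  obtain ⟨_, hiL⟩ := Encl.omap_spec hL
  have hi' : i < (List.range ks.length).length := by simpa using hi
  have e := hiL i hi'
  rw [List.getD_eq_getElem?_getD, List.getElem?_range hi, Option.getD_some] at e
  have hpair : trigFarScaledBox S Ke ke C.P (phaseBox S C i) m₀ B₄ s K = some ((L.getD i default).1, (L.getD i default).2) := by
    rw [e]
  exact mem_trigFarScaledBox hS hC.pi (mem_phaseBox hS hC hi) hB₄ hs hK hKe hpair

/-- Summability of a cosine far piece. -/
theorem summable_cos_far (φ : ℝ) {s : ℕ} (hs : 2 ≤ s) (m₀ B₄ : ℕ) :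
    Summable fun k : ℕ ↦ Real.cos ((B₄ + k : ℕ) * φ) * ((m₀ : ℝ) / ((B₄ + k : ℕ) : ℝ)) ^ s := by
  refine ((summable_cos_div_pow φ hs B₄).mul_left ((m₀ : ℝ) ^ s)).congr fun k ↦ ?_
  rw [div_pow]; ring

/-- Summability of a sine far piece. -/
theorem summable_sin_far (φ : ℝ) {s : ℕ} (hs : 2 ≤ s) (m₀ B₄ : ℕ) :
    Summable fun k : ℕ ↦ Real.sin ((B₄ + k : ℕ) * φ) * ((m₀ : ℝ) / ((B₄ + k : ℕ) : ℝ)) ^ s := by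
  refine ((summable_sin_div_pow φ hs B₄).mul_left ((m₀ : ℝ) ^ s)).congr fun k ↦ ?_
  rw [div_pow]; ring

/-- The far sum of `(0,2)` as a weighted list sum of single-frequency cosine tails. -/
theorem farSum_02_eq (hks : PrimeData a ks) {m₀ B₄ s : ℕ} (hs : 2 ≤ s) :
    farSum a m₀ B₄ 0 2 s = -(∑ i ∈ Finset.range ks.length, (ks.getD i default).wt *
        ∑' k : ℕ, Real.cos ((B₄ + k : ℕ) * (π * (ks.getD i default).len / a)) * ((m₀ : ℝ) / ((B₄ + k : ℕ) : ℝ)) ^ s) := by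
  have hterm : ∀ k : ℕ, tagT a 0 (B₄ + k) * tagT a 2 (B₄ + k) * ((m₀ : ℝ) / ((B₄ + k : ℕ) : ℝ)) ^ s
      = -(∑ i ∈ Finset.range ks.length, (ks.getD i default).wt *
          (Real.cos ((B₄ + k : ℕ) * (π * (ks.getD i default).len / a)) * ((m₀ : ℝ) / ((B₄ + k : ℕ) : ℝ)) ^ s)) := by
    intro k
    rw [tagT_zero, tagT_two, Encl.sum_weilPrimeIndex_eq_listSum hks, Encl.list_sum_map_eq_sum_range, one_mul, neg_mul,
      Finset.sum_mul]
    congr 1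
    refine Finset.sum_congr rfl fun i _ ↦ ?_
    rw [PrimeLen.log_val]; ring_nf
  have hsum : ∀ i ∈ Finset.range ks.length, Summable fun k : ℕ ↦ (ks.getD i default).wt *
      (Real.cos ((B₄ + k : ℕ) * (π * (ks.getD i default).len / a)) * ((m₀ : ℝ) / ((B₄ + k : ℕ) : ℝ)) ^ s) :=
    fun i _ ↦ (summable_cos_far _ hs m₀ B₄).mul_left _
  unfold farSum
  simp_rw [hterm]
  rw [tsum_neg, Summable.tsum_finsetSum hsum]
  congr 1
  refine Finset.sum_congr rfl fun i _ ↦ ?_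
  exact tsum_mul_left

/-- The far sum of `(0,3)` as a weighted list sum of single-frequency sine tails. -/
theorem farSum_03_eq (hks : PrimeData a ks) {m₀ B₄ s : ℕ} (hs : 2 ≤ s) :
    farSum a m₀ B₄ 0 3 s = ∑ i ∈ Finset.range ks.length, (ks.getD i default).wt *
        ∑' k : ℕ, Real.sin ((B₄ + k : ℕ) * (π * (ks.getD i default).len / a)) * ((m₀ : ℝ) / ((B₄ + k : ℕ) : ℝ)) ^ s := by
  have hterm : ∀ k : ℕ, tagT a 0 (B₄ + k) * tagT a 3 (B₄ + k) * ((m₀ : ℝ) / ((B₄ + k : ℕ) : ℝ)) ^ s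
      = ∑ i ∈ Finset.range ks.length, (ks.getD i default).wt *
          (Real.sin ((B₄ + k : ℕ) * (π * (ks.getD i default).len / a)) * ((m₀ : ℝ) / ((B₄ + k : ℕ) : ℝ)) ^ s) := by
    intro k
    rw [tagT_zero, tagT_three, Encl.sum_weilPrimeIndex_eq_listSum hks, Encl.list_sum_map_eq_sum_range, one_mul, Finset.sum_mul]
    refine Finset.sum_congr rfl fun i _ ↦ ?_
    rw [PrimeLen.log_val]; ring_nf
  have hsum : ∀ i ∈ Finset.range ks.length, Summable fun k : ℕ ↦ (ks.getD i default).wt *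
      (Real.sin ((B₄ + k : ℕ) * (π * (ks.getD i default).len / a)) * ((m₀ : ℝ) / ((B₄ + k : ℕ) : ℝ)) ^ s) :=
    fun i _ ↦ (summable_sin_far _ hs m₀ B₄).mul_left _
  unfold farSum
  simp_rw [hterm]
  rw [Summable.tsum_finsetSum hsum]
  refine Finset.sum_congr rfl fun i _ ↦ ?_
  exact tsum_mul_left

/-- ★ `far02 ∋ farSum (0,2)`: minus the weighted cosine far boxes. -/
theorem mem_far02 (hS : 0 < S) (hks : PrimeData a ks) (hC : ConstsValid S a ks C) {Ke ke m₀ B₄ s K : ℕ} (hB₄ : 1 ≤ B₄)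
    (hs : 2 ≤ s) (hK : 1 ≤ K) (hKe : Even K) {L : List (MI × MI)}
    (hL : trigFarList S Ke ke C ks.length m₀ B₄ s K = some L) :
    MI.mem S (farSum a m₀ B₄ 0 2 s) ((wsumCos S C.wts L ks.length).neg) := by
  rw [farSum_02_eq hks hs]
  refine MI.mem_neg (mem_sumBox ks.length fun i hi ↦ ?_)
  exact MI.mem_mul hS (hC.wts i hi) (mem_trigFarList hS hC hB₄ hs hK hKe hL hi).1

/-- ★ `far03 ∋ farSum (0,3)`: the weighted sine far boxes. -/
theorem mem_far03 (hS : 0 < S) (hks : PrimeData a ks) (hC : ConstsValid S a ks C) {Ke ke m₀ B₄ s K : ℕ} (hB₄ : 1 ≤ B₄)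
    (hs : 2 ≤ s) (hK : 1 ≤ K) (hKe : Even K) {L : List (MI × MI)}
    (hL : trigFarList S Ke ke C ks.length m₀ B₄ s K = some L) :
    MI.mem S (farSum a m₀ B₄ 0 3 s) (wsumSin S C.wts L ks.length) := by
  rw [farSum_03_eq hks hs]
  refine mem_sumBox ks.length fun i hi ↦ ?_
  exact MI.mem_mul hS (hC.wts i hi) (mem_trigFarList hS hC hB₄ hs hK hKe hL hi).2

end CinfHankelR

end Summit.RiemannHypothesis.RiemannHypothesis.Theorems.WeilFormatC
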